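import Literature.NumberTheory.EllipticCurves.BhargavaShankarFieldParametrization
import Literature.NumberTheory.EllipticCurves.PadicPointsFiniteIndexProofs
import HarnessLib

/-!
# Bhargava–Shankar, proof of Prop. 5.12: over `ℚ_p`, `Σ_{soluble classes} 1/#Aut(f) = #(E/2E)/#E[2]`

Topic `Literature/NumberTheory/EllipticCurves`; joins `BhargavaShankarFieldParametrization.lean`
(Lemma 5.10: the `ℚ_p`-soluble `PGL₂(ℚ_p)`-classes with invariants `(I, J)` ↔ `E(ℚ_p)/2E(ℚ_p)`;
Lemma 5.11: each has `#E(ℚ_p)[2]` automorphisms) with the tree's local masses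
(`Literature.NumberTheory.EllipticCurves.localSelmerRatio`, `BhargavaShankarLocalMasses.lean`) and
Lemma 5.16 (Brumer–Kramer, `brumerKramer_card_quotient_two_holds`).

Source: M. Bhargava, A. Shankar, Ann. of Math. (2) 181 (2015) 191–242, proof of Prop. 5.12 of
the held arXiv text `arXiv:1006.1002v2` (= Prop. 3.9/Cor. 3.8 of the published version), last
step: "By Lemmas 5.10 and 5.11, elements `f ∈ B_p^{I,J}` correspond bijectively with elements
`σ ∈ E_{I,J}/2E_{I,J}`, and the cardinality of `Aut(f)` is equal to the cardinality of
`E_{I,J}(ℚ_p)[2]`", so that `Σ_{f ∈ B_p^{I,J}} 1/#Aut(f) = Σ_{σ ∈ E/2E} 1/#E[2](ℚ_p)` — the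
integrand of `M_p(V,F)`. Here `B_p^{I,J}` is a set of representatives of the `ℚ_p`-soluble
`PGL₂(ℚ_p)`-classes of forms with invariants `(I, J)`, `Aut(f)` the stabiliser in `PGL₂(ℚ_p)`.

* `BinaryQuartic.finite_solubleClasses_padic` — over `ℚ_p` there are finitely many soluble
  classes with invariants `(I, J)` (`4I³ ≠ J²`), namely `#(E(ℚ_p)/2E(ℚ_p))` of them
  (`natCard_solubleClasses_padic`);
* `BinaryQuartic.finsum_inv_pgl2StabilizerCard_eq_localSelmerRatio` — **the identity of the proof of
  Prop. 5.12**: `Σ_{classes} 1/#Aut = #(E(ℚ_p)/2E(ℚ_p))/#E(ℚ_p)[2] = localSelmerRatio p (I, J)`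
  for `(I, J) ∈ ℤ_p²` off `4I³ = J²` (any representatives; the stabiliser size is class-independent).

## References

* [BhargavaShankarAnnals2015] proof of Prop. 5.12 (arXiv:1006.1002v2 numbering).
  [cite: BhargavaShankarAnnals2015, proof of Prop. 5.12 (arXiv:1006.1002v2 numbering)]
-/

noncomputable section

open scoped Classical

namespace Literature.NumberTheory.EllipticCurves

namespace BinaryQuartic

variable (p : ℕ) [Fact p.Prime]

/-- Off `4I³ = J²` (in `ℤ_p`), the invariants are off the discriminant locus in `ℚ_p`. [folklore] -/
theorem four_mul_pow_sub_sq_cast_ne_zero {IJ : ℤ_[p] × ℤ_[p]} (h : 4 * IJ.1 ^ 3 - IJ.2 ^ 2 ≠ 0) :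
    4 * (IJ.1 : ℚ_[p]) ^ 3 - (IJ.2 : ℚ_[p]) ^ 2 ≠ 0 := by
  have : ((4 * IJ.1 ^ 3 - IJ.2 ^ 2 : ℤ_[p]) : ℚ_[p]) ≠ 0 := by
    rw [Ne, PadicInt.coe_eq_zero]; exact h
  push_cast at this
  exact this

/-- `#(E_{I,J}(ℚ_p)/2E_{I,J}(ℚ_p)) = c_p · #E_{I,J}(ℚ_p)[2]` is finite and positive (Lemma 5.16,
Brumer–Kramer, the tree's `brumerKramer_card_quotient_two_holds`, with `#E[2] ≥ 1` finite).
[cite: BhargavaShankarAnnals2015, Lemma 5.16 (arXiv:1006.1002v2 numbering)] -/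
theorem natCard_quotient_two_pos {IJ : ℤ_[p] × ℤ_[p]} (h : 4 * IJ.1 ^ 3 - IJ.2 ^ 2 ≠ 0) :
    0 < Nat.card ((curveOfInvariants ℚ_[p] (IJ.1 : ℚ_[p]) (IJ.2 : ℚ_[p])).toAffine.Point ⧸
      (zsmulAddGroupHom
        (α := (curveOfInvariants ℚ_[p] (IJ.1 : ℚ_[p]) (IJ.2 : ℚ_[p])).toAffine.Point) 2).range) := by
  haveI := isElliptic_curveOfInvariants_of_ne (four_mul_pow_sub_sq_cast_ne_zero p h)
  rw [brumerKramer_card_quotient_two_holds p (curveOfInvariants ℚ_[p] (IJ.1 : ℚ_[p]) (IJ.2 : ℚ_[p]))]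
  have hfin := finite_torsionBy_two (curveOfInvariants ℚ_[p] (IJ.1 : ℚ_[p]) (IJ.2 : ℚ_[p]))
    rfl rfl two_ne_zero
  haveI : Finite (AddSubgroup.torsionBy
      (curveOfInvariants ℚ_[p] (IJ.1 : ℚ_[p]) (IJ.2 : ℚ_[p])).toAffine.Point 2) := hfin.to_subtype
  refine Nat.mul_pos ?_ Nat.card_pos
  split_ifs <;> norm_num

/-- **Over `ℚ_p` the soluble classes with invariants `(I, J)` are finite in number** (Lemma 5.10 +
Lemma 5.16). [cite: BhargavaShankarAnnals2015, Lemmas 5.10 and 5.16 (arXiv:1006.1002v2 numbering)] -/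
theorem finite_solubleClasses_padic {IJ : ℤ_[p] × ℤ_[p]} (h : 4 * IJ.1 ^ 3 - IJ.2 ^ 2 ≠ 0) :
    Finite (Quotient (pgl2Setoid (IJ.1 : ℚ_[p]) (IJ.2 : ℚ_[p]))) := by
  have hc := natCard_solubleClasses_eq (K := ℚ_[p]) (four_mul_pow_sub_sq_cast_ne_zero p h)
  refine Nat.finite_of_card_ne_zero ?_
  rw [hc]
  exact (natCard_quotient_two_pos p h).ne'

/-- `#{soluble classes with invariants (I, J)} = #(E_{I,J}(ℚ_p)/2E_{I,J}(ℚ_p))` over `ℚ_p`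
(Lemma 5.10). [cite: BhargavaShankarAnnals2015, Lemma 5.10 (arXiv:1006.1002v2 numbering)] -/
theorem natCard_solubleClasses_padic {IJ : ℤ_[p] × ℤ_[p]} (h : 4 * IJ.1 ^ 3 - IJ.2 ^ 2 ≠ 0) :
    Nat.card (Quotient (pgl2Setoid (IJ.1 : ℚ_[p]) (IJ.2 : ℚ_[p]))) =
      Nat.card ((curveOfInvariants ℚ_[p] (IJ.1 : ℚ_[p]) (IJ.2 : ℚ_[p])).toAffine.Point ⧸
        (zsmulAddGroupHom
          (α := (curveOfInvariants ℚ_[p] (IJ.1 : ℚ_[p]) (IJ.2 : ℚ_[p])).toAffine.Point) 2).range) :=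
  natCard_solubleClasses_eq (four_mul_pow_sub_sq_cast_ne_zero p h)

/-- **Bhargava–Shankar, proof of Prop. 5.12, last step**: for `(I, J) ∈ ℤ_p²` with `4I³ ≠ J²`,
summing `1/#Aut(f)` (`Aut(f)` = stabiliser in `PGL₂(ℚ_p)`) over representatives `f` of the
`ℚ_p`-soluble `PGL₂(ℚ_p)`-classes of binary quartic forms with invariants `(I, J)` gives
`#(E_{I,J}(ℚ_p)/2E_{I,J}(ℚ_p)) / #E_{I,J}(ℚ_p)[2]`, the integrand `localSelmerRatio p (I, J)` of the
local mass `M_p(V,F)` ("By Lemmas 5.10 and 5.11 …"). The representative of a class `c` is taken to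
be `c.out`; any other choice gives the same summand. [cite: BhargavaShankarAnnals2015, proof of Prop. 5.12 (arXiv:1006.1002v2 numbering)] -/
theorem finsum_inv_pgl2StabilizerCard_eq_localSelmerRatio {IJ : ℤ_[p] × ℤ_[p]}
    (h : 4 * IJ.1 ^ 3 - IJ.2 ^ 2 ≠ 0) :
    ∑ᶠ c : Quotient (pgl2Setoid (IJ.1 : ℚ_[p]) (IJ.2 : ℚ_[p])),
        (1 : ℝ) / pgl2StabilizerCard (c.out : solubleForms (IJ.1 : ℚ_[p]) (IJ.2 : ℚ_[p])).1 =
      localSelmerRatio p IJ := by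
  have hΔ := four_mul_pow_sub_sq_cast_ne_zero p h
  haveI := finite_solubleClasses_padic p h
  haveI := Fintype.ofFinite (Quotient (pgl2Setoid (IJ.1 : ℚ_[p]) (IJ.2 : ℚ_[p])))
  -- every summand is `1/#E[2]`
  have hterm : ∀ c : Quotient (pgl2Setoid (IJ.1 : ℚ_[p]) (IJ.2 : ℚ_[p])),
      (1 : ℝ) / pgl2StabilizerCard (c.out : solubleForms (IJ.1 : ℚ_[p]) (IJ.2 : ℚ_[p])).1 =
        1 / Nat.card (AddSubgroup.torsionBy
          (curveOfInvariants ℚ_[p] (IJ.1 : ℚ_[p]) (IJ.2 : ℚ_[p])).toAffine.Point (2 : ℤ)) := by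
    intro c
    rw [pgl2StabilizerCard_eq_of_mem_solubleForms hΔ (c.out).2]
  rw [finsum_eq_sum_of_fintype]
  simp only [hterm, Finset.sum_const, Finset.card_univ, nsmul_eq_mul]
  rw [Fintype.card_eq_nat_card, natCard_solubleClasses_padic p h, localSelmerRatio, if_pos h]
  ring

end BinaryQuartic

end Literature.NumberTheory.EllipticCurves

end
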